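import Summits.Ventures.Crystal3D.Theorems.StickyWulffConstantGenericWallFloorStackLedgerLocalCount
import Summits.Ventures.Crystal3D.Theorems.StickyWulffConstantGenericWallFloorStackWalkStarExclusion
import Summits.Ventures.Crystal3D.Theorems.StickyWulffConstantGenericWallFloorStackWalkRigidity
import HarnessLib

/-!
# The WORD CRITERION for ray separation: chain pairs whose end mirrors contain the steep slots
# (crux `GenericWallFloor`, line `WallLedgerG`; forced-chain localisation of the stack ledger, brick 6)

HONEST FRAMING. Part of the venture `Summits/Ventures/Crystal3D` (cell `crystal3d-full`), helper `--supports` the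
crux `GenericWallFloor` (stmt-Ventures-19480) of `route-Ventures-StickyWulffConstant`, registered line `WallLedgerG`,
open stub `stub_twoSlabAdhesion` (general fillings).  The separated-frame-set ledger
(`twoSlabAdhesion_stackLedger_local_sep`) is residual-free at full charge whenever no frame a grain-1 walker can
carry is co-axial with a frame a grain-2 walker can carry.  This file gives a CHECKABLE sufficient condition for
that separation on CHAIN pairs (`Σ3ⁿ`-related lattices), the case the non-chain families cannot reach:

**`not_coaxial_of_word`.**  Present the far lattice over the near frame by a reduced model menu word `κ` of length
`≥ 2` (`A₂·Λ₀ = (wordFrame A₁ κ)·Λ₀`; letters = unit model `{111}` normals, consecutive ones at `±1/3`).  If the near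
steep slot `u₁` lies IN the first mirror plane (`⟪u₁, μ⟫ = 0`, `μ` the letter applied first) and the far steep
slot `u₂` lies IN the last mirror plane, then no frame on a sound well-formed stack over `(A₁, u₁, 0)` is co-axial
with a frame on a sound well-formed stack over `(A₂, u₂, 0)`.  For `|κ| = 2` these are the `Σ9` cells both of
whose steep slots lie in the respective composition planes; only the two END letters of `κ` matter.
Mechanism: stack frames are word frames over their base (`frame_eq_wordFrame`), the far ones transported to the base
`A₁` through the lattice symmetry `(wordFrame A₁ κ)⁻¹ ∘ A₂` (`wordFrame_trans`, `wordFrame_append`); co-axial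
lattices are equal or once more reflected (`eq_or_twin_of_coaxial`); reduced menu words with one slot dozen have
one mirror sequence (`map_reflection_eq_of_image_eq`, resting on 19481-p2's NonReturn); and the near word is short
or ends with the first push normal (POSITIVE on `u₁`, `inner_dir_getLast_stackWord`) while the transported far word
has length `≥ 2` and ends with `κ`'s first letter (ORTHOGONAL to `u₁`) — `false_of_map_reflection_eq`.
The ledger corollary is `twoSlabAdhesion_stackLedger_local_word` (`…StackLedgerLocalWord`).

WHAT THIS IS NOT: not the stub; ray-ALIGNED chain pairs (a steep slot off its end mirror plane) are not touched —
there steep walkers can thread a lamella (ROUTE.md §83(viii)); F-C1 not moved.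
-/

noncomputable section

namespace Summit.Ventures.Crystal3D.Theorems

open Summit.Ventures.Crystal3D Finset
open Literature.MathematicalPhysics.StatisticalMechanics (fccStacking barlowStacking IsHaggSeq)
open scoped InnerProductSpace

/-! ### Word algebra -/

/-- Appending words composes their frames: `wordFrame B (β ++ κ) = wordFrame (wordFrame B κ) β`. -/
theorem wordFrame_append (B : EuclideanSpace ℝ (Fin 3) ≃ₗᵢ[ℝ] EuclideanSpace ℝ (Fin 3)) :
    ∀ β κ : List (EuclideanSpace ℝ (Fin 3)), wordFrame B (β ++ κ) = wordFrame (wordFrame B κ) β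
  | [], _ => rfl
  | μ :: β, κ => by rw [List.cons_append, wordFrame_cons, wordFrame_cons, wordFrame_append B β κ]

/-- Conjugating a model reflection through an isometry: `R_μ.trans S = S.trans R_{S μ}` (unit `μ`). -/
theorem reflection_trans_eq_trans_reflection (S : EuclideanSpace ℝ (Fin 3) ≃ₗᵢ[ℝ] EuclideanSpace ℝ (Fin 3))
    {μ : EuclideanSpace ℝ (Fin 3)} (hμ : ‖μ‖ = 1) :
    ((ℝ ∙ μ)ᗮ.reflection).trans S = S.trans ((ℝ ∙ (S μ))ᗮ.reflection) :=
  LinearIsometryEquiv.ext fun x => by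
    have hSμ : ‖S μ‖ = 1 := by rw [LinearIsometryEquiv.norm_map, hμ]
    rw [LinearIsometryEquiv.trans_apply, LinearIsometryEquiv.trans_apply, reflection_unit_apply hμ,
      reflection_unit_apply hSμ, mirror_conj]

/-- **Transport of a word through a base change**: `wordFrame (S.trans W) β = S.trans (wordFrame W (β.map S))`
for a word of unit letters. -/
theorem wordFrame_trans (W S : EuclideanSpace ℝ (Fin 3) ≃ₗᵢ[ℝ] EuclideanSpace ℝ (Fin 3)) :
    ∀ β : List (EuclideanSpace ℝ (Fin 3)), (∀ μ ∈ β, ‖μ‖ = 1) →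
      wordFrame (S.trans W) β = S.trans (wordFrame W (β.map S))
  | [], _ => rfl
  | μ :: β, h => by
    rw [wordFrame_cons, List.map_cons, wordFrame_cons,
      wordFrame_trans W S β (fun ν hν => h ν (List.mem_cons_of_mem _ hν)), LinearIsometryEquiv.trans_assoc,
      reflection_trans_eq_trans_reflection S (h μ List.mem_cons_self), ← LinearIsometryEquiv.trans_assoc]

/-- Cancellation of a repeated mirror: `wordFrame B (μ :: μ' :: γ) = wordFrame B γ` when `R_μ = R_{μ'}`. -/
theorem wordFrame_cons_cons_cancel (B : EuclideanSpace ℝ (Fin 3) ≃ₗᵢ[ℝ] EuclideanSpace ℝ (Fin 3))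
    {μ μ' : EuclideanSpace ℝ (Fin 3)} (h : (ℝ ∙ μ)ᗮ.reflection = (ℝ ∙ μ')ᗮ.reflection)
    (γ : List (EuclideanSpace ℝ (Fin 3))) : wordFrame B (μ :: μ' :: γ) = wordFrame B γ := by
  rw [wordFrame_cons, wordFrame_cons, LinearIsometryEquiv.trans_assoc, h,
    Submodule.reflection_trans_reflection, LinearIsometryEquiv.refl_trans]

/-- The image of a set under a composite isometry. -/
theorem image_trans_eq (S V : EuclideanSpace ℝ (Fin 3) ≃ₗᵢ[ℝ] EuclideanSpace ℝ (Fin 3))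
    (T : Set (EuclideanSpace ℝ (Fin 3))) :
    (S.trans V : EuclideanSpace ℝ (Fin 3) → EuclideanSpace ℝ (Fin 3)) '' T =
      (V : EuclideanSpace ℝ (Fin 3) → EuclideanSpace ℝ (Fin 3)) '' ((S : EuclideanSpace ℝ (Fin 3) → _) '' T) := by
  rw [LinearIsometryEquiv.coe_trans, Set.image_comp]

/-- A linear isometry fixing the lattice `Λ₀` fixes the slot dozen. -/
theorem image_fccSlots_eq_self_of_image_fcc (S : EuclideanSpace ℝ (Fin 3) ≃ₗᵢ[ℝ] EuclideanSpace ℝ (Fin 3))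
    (hS : S '' fccStacking 1 (Real.sqrt (2 / 3)) = fccStacking 1 (Real.sqrt (2 / 3))) :
    (S : EuclideanSpace ℝ (Fin 3) → EuclideanSpace ℝ (Fin 3)) '' ↑fccSlots = ↑fccSlots := by
  have h := image_fccSlots_eq_of_image_fcc_eq S (LinearIsometryEquiv.refl ℝ _)
    (by rw [hS, LinearIsometryEquiv.coe_refl, Set.image_id])
  rw [h, LinearIsometryEquiv.coe_refl, Set.image_id]

/-- Two unit MODEL menu normals meet at `±1` or `±1/3`. -/
theorem inner_modelMenu {μ μ' : EuclideanSpace ℝ (Fin 3)} (hμ : ‖μ‖ = 1) (hμ' : ‖μ'‖ = 1)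
    (hm : ∀ w ∈ fccSlots, ⟪w, μ⟫_ℝ = 0 ∨ ⟪w, μ⟫_ℝ = Real.sqrt (2 / 3) ∨ ⟪w, μ⟫_ℝ = -Real.sqrt (2 / 3))
    (hm' : ∀ w ∈ fccSlots, ⟪w, μ'⟫_ℝ = 0 ∨ ⟪w, μ'⟫_ℝ = Real.sqrt (2 / 3) ∨ ⟪w, μ'⟫_ℝ = -Real.sqrt (2 / 3)) :
    ⟪μ, μ'⟫_ℝ = 1 ∨ ⟪μ, μ'⟫_ℝ = -1 ∨ ⟪μ, μ'⟫_ℝ = 1 / 3 ∨ ⟪μ, μ'⟫_ℝ = -1 / 3 :=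
  inner_menuNormals (LinearIsometryEquiv.refl ℝ _) hμ hμ' (fun w hw => by simpa using hm w hw)
    (fun w hw => by simpa using hm' w hw)

/-! ### Stack facts -/

variable {z : EuclideanSpace ℝ (Fin 3)}

/-- Every entry of a sound well-formed stack is the top of a sound well-formed SUFFIX with the same bottom. -/
theorem exists_suffix_of_mem : ∀ (stk : List WalkEntry) (e : WalkEntry), e ∈ stk → StackSound z stk → StackWF z stk →
    ∃ r : List WalkEntry, StackSound z (e :: r) ∧ StackWF z (e :: r) ∧ (e :: r).getLast? = stk.getLast?
  | [], _, he, _, _ => by simp at he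
  | e' :: rest, e, he, hS, hW => by
    rcases List.mem_cons.1 he with rfl | hmem
    · exact ⟨rest, hS, hW, rfl⟩
    · cases rest with
      | nil => simp at hmem
      | cons e'' rest' =>
        obtain ⟨r, hSr, hWr, hlr⟩ := exists_suffix_of_mem (e'' :: rest') e hmem hS.2.2 hW.2.2
        exact ⟨r, hSr, hWr, by rw [hlr, List.getLast?_cons_cons]⟩

/-- The base frame of a stack with bottom `⟨A, u, n⟩` is `A`. -/
theorem stackBase_eq_of_getLast? {stk : List WalkEntry} {A : EuclideanSpace ℝ (Fin 3) ≃ₗᵢ[ℝ] EuclideanSpace ℝ (Fin 3)}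
    {u n : EuclideanSpace ℝ (Fin 3)} (h : stk.getLast? = some ⟨A, u, n⟩) : stackBase stk = A := by
  rw [stackBase_eq_getLast?, h]; rfl

/-- **The first push normal is positive on the bottom direction**: the LAST letter `μ` of the word of a sound
stack with bottom `b` has `⟪b.dir, μ⟫ = √(2/3)`. -/
theorem inner_dir_getLast_stackWord : ∀ (rest : List WalkEntry) (e b : WalkEntry), StackSound z (e :: rest) →
    (e :: rest).getLast? = some b → ∀ μ, (stackWord (e :: rest)).getLast? = some μ → ⟪b.dir, μ⟫_ℝ = Real.sqrt (2 / 3)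
  | [], _, _, _, _, μ, hμ => by simp at hμ
  | e' :: rest', e, b, hS, hlast, μ, hμ => by
    obtain ⟨-, hLi, hS'⟩ := hS
    rw [List.getLast?_cons_cons] at hlast
    cases rest' with
    | nil =>
      rw [List.getLast?_singleton] at hlast
      obtain rfl := Option.some.inj hlast
      rw [stackWord_cons_cons, stackWord_singleton, List.getLast?_singleton] at hμ
      obtain rfl := Option.some.inj hμ
      rw [← LinearIsometryEquiv.inner_map_map e'.frame, LinearIsometryEquiv.apply_symm_apply]
      exact hLi.2
    | cons e'' rest'' =>
      rw [stackWord_cons_cons, stackWord_cons_cons, List.getLast?_cons_cons] at hμ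
      exact inner_dir_getLast_stackWord (e'' :: rest'') e' b hS' hlast μ (by rwa [stackWord_cons_cons])

/-! ### The contradiction behind the word criterion -/

/-- **Mirror sequences with incompatible ends.**  If two words of unit letters have the same mirror sequence,
the first has length `≤ 1` or a last letter POSITIVE on `u₁` (`⟪u₁, λ⟫ = √(2/3)`), and the second has length
`≥ 2` and a last letter ORTHOGONAL to `u₁`, that is absurd. -/
theorem false_of_map_reflection_eq {u₁ : EuclideanSpace ℝ (Fin 3)} {α γ : List (EuclideanSpace ℝ (Fin 3))}
    (hαu : ∀ μ ∈ α, ‖μ‖ = 1) (hγu : ∀ μ ∈ γ, ‖μ‖ = 1)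
    (hP : α.length ≤ 1 ∨ ∃ lam, α.getLast? = some lam ∧ ⟪u₁, lam⟫_ℝ = Real.sqrt (2 / 3))
    (hγ2 : 2 ≤ γ.length) (hγlast : ∃ μ, γ.getLast? = some μ ∧ ⟪u₁, μ⟫_ℝ = 0)
    (hmap : α.map (fun μ => (ℝ ∙ μ)ᗮ.reflection) = γ.map (fun μ => (ℝ ∙ μ)ᗮ.reflection)) : False := by
  have hlen : α.length = γ.length := by simpa using congrArg List.length hmap
  rcases hP with h1 | ⟨lam, hlam, hpos⟩
  · omega
  obtain ⟨μ, hμ, hμ0⟩ := hγlast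
  have hlast := congrArg List.getLast? hmap
  rw [List.getLast?_map, List.getLast?_map, hlam, hμ, Option.map_some, Option.map_some, Option.some.injEq] at hlast
  have hlamu : ‖lam‖ = 1 := hαu lam (List.mem_of_getLast? hlam)
  have hμu : ‖μ‖ = 1 := hγu μ (List.mem_of_getLast? hμ)
  have hr : 0 < Real.sqrt (2 / 3) := Real.sqrt_pos.2 (by norm_num)
  rcases eq_or_eq_neg_of_reflection_eq hlamu hμu hlast with h | h
  · rw [h, hμ0] at hpos; linarith
  · rw [h, inner_neg_right, hμ0, neg_zero] at hpos; linarith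

/-- The "length `≤ 1` or positive last letter" property of a word whose every last letter is positive. -/
theorem length_le_one_or_getLast_pos {u₁ : EuclideanSpace ℝ (Fin 3)} (α : List (EuclideanSpace ℝ (Fin 3)))
    (hpos : ∀ μ, α.getLast? = some μ → ⟪u₁, μ⟫_ℝ = Real.sqrt (2 / 3)) :
    α.length ≤ 1 ∨ ∃ lam, α.getLast? = some lam ∧ ⟪u₁, lam⟫_ℝ = Real.sqrt (2 / 3) := by
  cases h : α.getLast? with
  | none => left; rw [List.getLast?_eq_none_iff] at h; rw [h]; simp
  | some lam => exact Or.inr ⟨lam, rfl, hpos lam h⟩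

/-! ### Separation from a word presentation of the pair -/

/-- **Word criterion for ray separation.**  Let the far lattice be presented over the near frame by a REDUCED
model menu word `κ` (unit model `{111}` normals, consecutive letters at `±1/3`) of length `≥ 2`:
`A₂·Λ₀ = (wordFrame A₁ κ)·Λ₀`; suppose the near steep slot `u₁` lies in the FIRST mirror plane (`⟪u₁, μ⟫ = 0`
for the last letter `μ` of `κ` — the mirror applied first to `A₁`) and the far steep slot `u₂` lies in the LAST
mirror plane (`⟪A₂ u₂, (wordFrame A₁ κ) μ'⟫ = 0` for the head letter `μ'`).  Then no frame of a sound well-formed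
stack over `(A₁, u₁, 0)` is co-axial with a frame of a sound well-formed stack over `(A₂, u₂, 0)`.
Mechanism: both frames are word frames over `A₁` (the far one after transport through the lattice symmetry
`S = (wordFrame A₁ κ)⁻¹ ∘ A₂`); co-axial frames have equal or once-more-reflected lattices
(`eq_or_twin_of_coaxial`); reduced menu words with the same slot dozen have the same mirror sequence
(`map_reflection_eq_of_image_eq`, 19481-p2's NonReturn); but the near word ends with a letter positive on `u₁`
(the first push normal) or has length `≤ 1`, while the transported far word ends with `κ`'s first letter,
orthogonal to `u₁`, and has length `≥ 2`. -/
theorem not_coaxial_of_word {A₁ A₂ : EuclideanSpace ℝ (Fin 3) ≃ₗᵢ[ℝ] EuclideanSpace ℝ (Fin 3)}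
    {u₁ u₂ : EuclideanSpace ℝ (Fin 3)} (κ : List (EuclideanSpace ℝ (Fin 3)))
    (hκl : ∀ μ ∈ κ, ‖μ‖ = 1 ∧
      ∀ w ∈ fccSlots, ⟪w, μ⟫_ℝ = 0 ∨ ⟪w, μ⟫_ℝ = Real.sqrt (2 / 3) ∨ ⟪w, μ⟫_ℝ = -Real.sqrt (2 / 3))
    (hκc : List.IsChain (fun μ μ' => ⟪μ, μ'⟫_ℝ = 1 / 3 ∨ ⟪μ, μ'⟫_ℝ = -1 / 3) κ) (hκ2 : 2 ≤ κ.length)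
    (hA₂ : A₂ '' fccStacking 1 (Real.sqrt (2 / 3)) = (wordFrame A₁ κ) '' fccStacking 1 (Real.sqrt (2 / 3)))
    (hfirst : ∀ μ, κ.getLast? = some μ → ⟪u₁, μ⟫_ℝ = 0)
    (hlast : ∀ μ, κ.head? = some μ → ⟪A₂ u₂, wordFrame A₁ κ μ⟫_ℝ = 0)
    {z₁ z₂ : EuclideanSpace ℝ (Fin 3)} {stk₁ stk₂ : List WalkEntry}
    (hS₁ : StackSound z₁ stk₁) (hW₁ : StackWF z₁ stk₁) (hl₁ : stk₁.getLast? = some ⟨A₁, u₁, 0⟩)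
    (hS₂ : StackSound z₂ stk₂) (hW₂ : StackWF z₂ stk₂) (hl₂ : stk₂.getLast? = some ⟨A₂, u₂, 0⟩)
    {e₁ e₂ : WalkEntry} (he₁ : e₁ ∈ stk₁) (he₂ : e₂ ∈ stk₂) :
    ¬ ∃ (L : EuclideanSpace ℝ (Fin 3) ≃ₗᵢ[ℝ] EuclideanSpace ℝ (Fin 3))
        (s₁ s₂ : EuclideanSpace ℝ (Fin 3)) (σ σ' : ℤ → ℤ), IsHaggSeq σ ∧ IsHaggSeq σ' ∧
        e₁.frame '' fccStacking 1 (Real.sqrt (2 / 3)) ⊆ (fun p => L p + s₁) '' barlowStacking 1 (Real.sqrt (2 / 3)) σ ∧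
        e₂.frame '' fccStacking 1 (Real.sqrt (2 / 3)) ⊆ (fun p => L p + s₂) '' barlowStacking 1 (Real.sqrt (2 / 3)) σ' := by
  intro hco
  have hr : 0 < Real.sqrt (2 / 3) := Real.sqrt_pos.2 (by norm_num)
  -- suffixes with the given tops
  obtain ⟨r₁, hS₁', hW₁', hl₁'⟩ := exists_suffix_of_mem stk₁ e₁ he₁ hS₁ hW₁
  obtain ⟨r₂, hS₂', hW₂', hl₂'⟩ := exists_suffix_of_mem stk₂ e₂ he₂ hS₂ hW₂
  rw [hl₁] at hl₁'
  rw [hl₂] at hl₂'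
  -- the two stack words
  obtain ⟨hαl, hαc⟩ := stackWord_letters _ hS₁' hW₁'
  obtain ⟨hβl, hβc⟩ := stackWord_letters _ hS₂' hW₂'
  have hF₁ : e₁.frame = wordFrame A₁ (stackWord (e₁ :: r₁)) := by
    rw [frame_eq_wordFrame e₁ r₁ hS₁', stackBase_eq_of_getLast? hl₁']
  have hF₂ : e₂.frame = wordFrame A₂ (stackWord (e₂ :: r₂)) := by
    rw [frame_eq_wordFrame e₂ r₂ hS₂', stackBase_eq_of_getLast? hl₂']
  have hαpos : ∀ μ, (stackWord (e₁ :: r₁)).getLast? = some μ → ⟪u₁, μ⟫_ℝ = Real.sqrt (2 / 3) :=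
    fun μ hμ => inner_dir_getLast_stackWord r₁ e₁ ⟨A₁, u₁, 0⟩ hS₁' hl₁' μ hμ
  have hβpos : ∀ μ, (stackWord (e₂ :: r₂)).getLast? = some μ → ⟪u₂, μ⟫_ℝ = Real.sqrt (2 / 3) :=
    fun μ hμ => inner_dir_getLast_stackWord r₂ e₂ ⟨A₂, u₂, 0⟩ hS₂' hl₂' μ hμ
  -- the lattice symmetry `S = W⁻¹ ∘ A₂`
  obtain ⟨S, hS⟩ : ∃ S : EuclideanSpace ℝ (Fin 3) ≃ₗᵢ[ℝ] EuclideanSpace ℝ (Fin 3),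
      S = A₂.trans (wordFrame A₁ κ).symm := ⟨_, rfl⟩
  have hWS : ∀ x, wordFrame A₁ κ (S x) = A₂ x := fun x => by
    rw [hS, LinearIsometryEquiv.trans_apply, LinearIsometryEquiv.apply_symm_apply]
  have hA₂eq : A₂ = S.trans (wordFrame A₁ κ) :=
    LinearIsometryEquiv.ext fun x => by rw [LinearIsometryEquiv.trans_apply, hWS]
  have hSfcc : S '' fccStacking 1 (Real.sqrt (2 / 3)) = fccStacking 1 (Real.sqrt (2 / 3)) := by
    rw [hS, LinearIsometryEquiv.coe_trans, Set.image_comp, hA₂, Set.image_image]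
    simp
  have hSslots := image_fccSlots_eq_self_of_image_fcc S hSfcc
  have hSmem' : ∀ w ∈ fccSlots, S.symm w ∈ fccSlots := fun w hw => by
    have hw' : w ∈ (S : EuclideanSpace ℝ (Fin 3) → EuclideanSpace ℝ (Fin 3)) '' ↑fccSlots := by
      rw [hSslots]; exact Finset.mem_coe.2 hw
    obtain ⟨w', hw', hw'eq⟩ := hw'
    rw [← hw'eq, LinearIsometryEquiv.symm_apply_apply]; exact Finset.mem_coe.1 hw'
  -- the transported far word `γ = (β.map S) ++ κ`
  set β := stackWord (e₂ :: r₂) with hβ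
  have hβSl : ∀ μ ∈ β.map S, ‖μ‖ = 1 ∧
      ∀ w ∈ fccSlots, ⟪w, μ⟫_ℝ = 0 ∨ ⟪w, μ⟫_ℝ = Real.sqrt (2 / 3) ∨ ⟪w, μ⟫_ℝ = -Real.sqrt (2 / 3) := by
    intro μ hμ
    obtain ⟨ν, hν, rfl⟩ := List.mem_map.1 hμ
    obtain ⟨hνu, hνm⟩ := hβl ν hν
    refine ⟨by rw [LinearIsometryEquiv.norm_map, hνu], fun w hw => ?_⟩
    have hsw : ⟪w, S ν⟫_ℝ = ⟪S.symm w, ν⟫_ℝ := by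
      rw [← LinearIsometryEquiv.inner_map_map S (S.symm w) ν, LinearIsometryEquiv.apply_symm_apply]
    rw [hsw]; exact hνm _ (hSmem' w hw)
  have hβSc : List.IsChain (fun μ μ' => ⟪μ, μ'⟫_ℝ = 1 / 3 ∨ ⟪μ, μ'⟫_ℝ = -1 / 3) (β.map S) := by
    rw [List.isChain_map]; simpa only [LinearIsometryEquiv.inner_map_map] using hβc
  have hγl : ∀ μ ∈ β.map S ++ κ, ‖μ‖ = 1 ∧
      ∀ w ∈ fccSlots, ⟪w, μ⟫_ℝ = 0 ∨ ⟪w, μ⟫_ℝ = Real.sqrt (2 / 3) ∨ ⟪w, μ⟫_ℝ = -Real.sqrt (2 / 3) := by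
    intro μ hμ
    rcases List.mem_append.1 hμ with h | h
    · exact hβSl μ h
    · exact hκl μ h
  have hγc : List.IsChain (fun μ μ' => ⟪μ, μ'⟫_ℝ = 1 / 3 ∨ ⟪μ, μ'⟫_ℝ = -1 / 3) (β.map S ++ κ) := by
    rw [List.isChain_append]
    refine ⟨hβSc, hκc, fun x hx y hy => ?_⟩
    rw [List.getLast?_map, Option.mem_def, Option.map_eq_some_iff] at hx
    obtain ⟨ν, hν, rfl⟩ := hx
    rw [Option.mem_def] at hy
    obtain ⟨hxu, hxm⟩ := hβSl (S ν) (List.mem_map.2 ⟨ν, List.mem_of_getLast? hν, rfl⟩)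
    obtain ⟨hyu, hym⟩ := hκl y (List.mem_of_head? hy)
    -- the junction: `S ν` is positive on `S u₂`, `y` is orthogonal to it
    have hpos : ⟪S u₂, S ν⟫_ℝ = Real.sqrt (2 / 3) := by rw [LinearIsometryEquiv.inner_map_map]; exact hβpos ν hν
    have horth : ⟪S u₂, y⟫_ℝ = 0 := by
      rw [← LinearIsometryEquiv.inner_map_map (wordFrame A₁ κ), hWS]; exact hlast y hy
    rcases inner_modelMenu hxu hyu hxm hym with h | h | h | h
    · have heq : S ν = y := (inner_eq_one_iff_of_norm_eq_one (𝕜 := ℝ) hxu hyu).1 h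
      rw [heq, horth] at hpos; exact absurd hpos (ne_of_lt hr)
    · have heq : y = -S ν := eq_neg_of_inner_eq_neg_one' hxu hyu h
      rw [heq, inner_neg_right, hpos] at horth; linarith
    · exact Or.inl h
    · exact Or.inr h
  have hγ2 : 2 ≤ (β.map S ++ κ).length := by rw [List.length_append]; omega
  have hγlast : ∃ μ, (β.map S ++ κ).getLast? = some μ ∧ ⟪u₁, μ⟫_ℝ = 0 := by
    have hκne : κ ≠ [] := by rintro rfl; simp at hκ2
    obtain ⟨μ, hμ⟩ := Option.ne_none_iff_exists'.1 (mt List.getLast?_eq_none_iff.1 hκne)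
    exact ⟨μ, by rw [List.getLast?_append, hμ]; rfl, hfirst μ hμ⟩
  -- the far frame's slot dozen as a word over `A₁`
  have himg₂ : (e₂.frame : EuclideanSpace ℝ (Fin 3) → EuclideanSpace ℝ (Fin 3)) '' ↑fccSlots =
      (wordFrame A₁ (β.map S ++ κ) : EuclideanSpace ℝ (Fin 3) → EuclideanSpace ℝ (Fin 3)) '' ↑fccSlots := by
    rw [hF₂, hA₂eq, wordFrame_trans (wordFrame A₁ κ) S β (fun μ hμ => (hβl μ hμ).1), ← wordFrame_append,
      image_trans_eq, hSslots]
  -- the main step: a reduced word for a lattice co-axial with `e₁.frame`'s, compared with the far word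
  have main : ∀ α : List (EuclideanSpace ℝ (Fin 3)),
      (∀ μ ∈ α, ‖μ‖ = 1 ∧
        ∀ w ∈ fccSlots, ⟪w, μ⟫_ℝ = 0 ∨ ⟪w, μ⟫_ℝ = Real.sqrt (2 / 3) ∨ ⟪w, μ⟫_ℝ = -Real.sqrt (2 / 3)) →
      List.IsChain (fun μ μ' => ⟪μ, μ'⟫_ℝ = 1 / 3 ∨ ⟪μ, μ'⟫_ℝ = -1 / 3) α →
      (α.length ≤ 1 ∨ ∃ lam, α.getLast? = some lam ∧ ⟪u₁, lam⟫_ℝ = Real.sqrt (2 / 3)) →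
      (wordFrame A₁ α : EuclideanSpace ℝ (Fin 3) → EuclideanSpace ℝ (Fin 3)) '' ↑fccSlots =
        (wordFrame A₁ (β.map S ++ κ) : EuclideanSpace ℝ (Fin 3) → EuclideanSpace ℝ (Fin 3)) '' ↑fccSlots → False :=
    fun α hl hc hP himg => false_of_map_reflection_eq (fun μ hμ => (hl μ hμ).1) (fun μ hμ => (hγl μ hμ).1) hP hγ2
      hγlast (map_reflection_eq_of_image_eq A₁ hl hc hγl hγc himg)
  rcases eq_or_twin_of_coaxial e₁.frame e₂.frame hco with hEq | ⟨m, hm, hmenu, hEq⟩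
  · -- equal lattices
    have himg := image_fccSlots_eq_of_image_fcc_eq _ _ hEq
    rw [hF₁, himg₂] at himg
    exact main _ hαl hαc (length_le_one_or_getLast_pos _ hαpos) himg
  · -- mirror twins: one more letter `m' = e₁.frame⁻¹ m` in front of the near word
    set m' := e₁.frame.symm m with hm'
    have hm'u : ‖m'‖ = 1 := by rw [hm', LinearIsometryEquiv.norm_map, hm]
    have hm'm : ∀ w ∈ fccSlots, ⟪w, m'⟫_ℝ = 0 ∨ ⟪w, m'⟫_ℝ = Real.sqrt (2 / 3) ∨ ⟪w, m'⟫_ℝ = -Real.sqrt (2 / 3) := by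
      intro w hw
      rw [hm', ← LinearIsometryEquiv.inner_map_map e₁.frame, LinearIsometryEquiv.apply_symm_apply]
      exact hmenu w hw
    have htw : twinFrame e₁.frame m = wordFrame A₁ (m' :: stackWord (e₁ :: r₁)) := by
      rw [twinFrame_eq_reflection_trans e₁.frame hm, wordFrame_cons, ← hm', ← hF₁]
    have himg := image_fccSlots_eq_of_image_fcc_eq _ _ hEq
    rw [himg₂, htw] at himg
    cases hα : stackWord (e₁ :: r₁) with
    | nil =>
      rw [hα] at himg
      exact main [m'] (fun μ hμ => by rw [List.mem_singleton] at hμ; rw [hμ]; exact ⟨hm'u, hm'm⟩)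
        (List.isChain_singleton _) (Or.inl (by simp)) himg.symm
    | cons a α' =>
      rw [hα] at himg hαl hαc hαpos
      obtain ⟨hau, ham⟩ := hαl a List.mem_cons_self
      have hPtail : α'.length ≤ 1 ∨ ∃ lam, α'.getLast? = some lam ∧ ⟪u₁, lam⟫_ℝ = Real.sqrt (2 / 3) := by
        refine length_le_one_or_getLast_pos α' fun μ hμ => hαpos μ ?_
        cases α' with
        | nil => simp at hμ
        | cons b α'' => rw [List.getLast?_cons_cons]; exact hμ
      have hPfull : (m' :: a :: α').length ≤ 1 ∨
          ∃ lam, (m' :: a :: α').getLast? = some lam ∧ ⟪u₁, lam⟫_ℝ = Real.sqrt (2 / 3) := by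
        right
        obtain ⟨lam, hlam⟩ := Option.ne_none_iff_exists'.1
          (mt List.getLast?_eq_none_iff.1 (List.cons_ne_nil a α'))
        exact ⟨lam, by rw [List.getLast?_cons_cons, hlam], hαpos lam hlam⟩
      rcases inner_modelMenu hm'u hau hm'm ham with h | h | h | h
      · -- `m' = a`: the two mirrors cancel
        have hma : m' = a := (inner_eq_one_iff_of_norm_eq_one (𝕜 := ℝ) hm'u hau).1 h
        rw [wordFrame_cons_cons_cancel A₁ (by rw [hma]) α'] at himg
        exact main α' (fun μ hμ => hαl μ (List.mem_cons_of_mem a hμ)) hαc.tail hPtail himg.symm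
      · -- `m' = −a`: the same mirror, cancel again
        have hma : a = -m' := eq_neg_of_inner_eq_neg_one' hm'u hau h
        have hR : (ℝ ∙ m')ᗮ.reflection = (ℝ ∙ a)ᗮ.reflection := by rw [hma, reflection_neg_eq hm'u]
        rw [wordFrame_cons_cons_cancel A₁ hR α'] at himg
        exact main α' (fun μ hμ => hαl μ (List.mem_cons_of_mem a hμ)) hαc.tail hPtail himg.symm
      · exact main (m' :: a :: α') (fun μ hμ => by
            rcases List.mem_cons.1 hμ with rfl | hμ'
            · exact ⟨hm'u, hm'm⟩
            · exact hαl μ hμ')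
          (List.isChain_cons.2 ⟨fun b hb => by
            rw [List.head?_cons, Option.mem_some_iff] at hb; rw [← hb]; exact Or.inl h, hαc⟩) hPfull himg.symm
      · exact main (m' :: a :: α') (fun μ hμ => by
            rcases List.mem_cons.1 hμ with rfl | hμ'
            · exact ⟨hm'u, hm'm⟩
            · exact hαl μ hμ')
          (List.isChain_cons.2 ⟨fun b hb => by
            rw [List.head?_cons, Option.mem_some_iff] at hb; rw [← hb]; exact Or.inr h, hαc⟩) hPfull himg.symm

end Summit.Ventures.Crystal3D.Theorems

end
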